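import Summits.BirchSwinnertonDyer.BirchSwinnertonDyer.Theorems.KolyvaginRoadThreeMethod2TameSign
import Summits.BirchSwinnertonDyer.BirchSwinnertonDyer.Theorems.KolyvaginRoadThreeMethod2LocalChebOfFrobenius
import Summits.BirchSwinnertonDyer.BirchSwinnertonDyer.Theorems.KolyvaginRoadThreeMethod2CruxOfOddRank
import Summits.BirchSwinnertonDyer.BirchSwinnertonDyer.Theorems.KolyvaginRoadThreeMethod2OddSelmerRank
import HarnessLib

/-!
# Route `KolyvaginRoadThree`, deciding crux `ZhangSharpFrameAtThreeHL` (item stmt-BirchSwinnertonDyer-19574):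
# the registered stub A `stub_levelRaisingAtThree` (v2x text) from (Cheb-Gal) + (Iso) — all LOCAL inputs discharged
# (cell `bsd-stepL`, seat `bsd-stepL-zhang3-p1` g7; `--supports stmt-BirchSwinnertonDyer-19574`, helper)

WHY THIS FILE. The five local–global inputs of koly3a's rank-lowering reduction (p464695) now stand as follows:
(Line), (Trans), (Equiv) are kernel theorems (`localLine_of_uAdmissible`, `localTrans_of_uAdmissible`,
`localEquiv_of_uAdmissible`); (Cheb) is reduced to its Galois form (Cheb-Gal) by `localCheb_of_galoisCheb`
(`KolyvaginRoadThreeMethod2LocalChebOfFrobenius`). This file states the end of the line for the LOCAL theory: the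
REGISTERED stub-A text VERBATIM ⟸ (Cheb-Gal) + (Iso), and the route decl BY NAME ⟸ (Cheb-Gal) + (Iso) + stub B + four
published facts. (Cheb-Gal) = Čebotarev with the sign rule in `Gal(K(E[3], x)/ℚ)` (Zhang Lemma 7.3 ∕ BD05 Thm 3.2 at
`p = 3`, koly MEMO-v8 §4; template `exists_kolyvaginPrime_gt`); (Iso) = Poitou–Tate isotropy (Zhang Prop. 5.4).
CONDITIONAL on these; nothing is booked; neither the stub nor the crux is proved; the owner assembles.
PARTITION: O2@3 (B10) × A1 × crux 19574 × stub A — none (reduction to two GLOBAL named inputs; T7).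

References: [cite: WZhang2014, Prop. 5.4, Lemma 7.3, §9 (9.1)–(9.3)] [cite: BertoliniDarmon2005, Lemma 2.6, Thm. 3.2]
[cite: GrossLMS1991, Prop. 9.6].
-/

noncomputable section

open scoped Classical

namespace Summit.BirchSwinnertonDyer.Rank1Residual.X11b.Three.Koly.Method2

open WeierstrassCurve NumberField IsDedekindDomain Field
  Literature.NumberTheory.EllipticCurves Literature.NumberTheory.EllipticCurves.ModularForms
  Literature.NumberTheory.EllipticCurves.Rank1Residual Literature.NumberTheory.GaloisRepresentations
  Summit.BirchSwinnertonDyer.Rank1Residual Summit.BirchSwinnertonDyer.Rank1Residual.X11b Module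

/-- **`stub_levelRaisingAtThree` — the REGISTERED v2x text — FROM (Cheb-Gal) + (Iso), frame-wise.** At every
Hoffstein–Luo A1 frame (`K` imaginary quadratic, so `[K : ℚ] = 2`) and every complex conjugation `c ≠ 1` with the
`ZMod 3`-structure of `H¹(K, E[3])`, the hypothesis asks only (Cheb) (a non-zero class of `SelQ n μ`, `n` good, has
non-zero localisation at some GOOD unipotent-admissible `q ∉ n`) and (Iso) (on a good level, at a good prime, the
localisations of two classes relaxed at `q` are proportional). The other three inputs of koly3a's
`selQ_rankLowering_on_of_localGlobal` are the kernel theorems `localEquiv_of_uAdmissible` (Zhang (9.2)),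
`localLine_of_uAdmissible`, `localTrans_of_uAdmissible` (Bertolini–Darmon Lemma 2.6 at `p = 3`). The conclusion is the
registered stub signature VERBATIM. CONDITIONAL on the two binders; nothing is booked.
[cite: WZhang2014, Prop. 5.4, Lemma 7.3, §9 (9.1)–(9.3)] [cite: BertoliniDarmon2005, Lemma 2.6, Thm. 3.2] -/
theorem stub_levelRaisingAtThree_of_galoisCheb_iso
    (hLG : ∀ (W : WeierstrassCurve ℚ) [W.IsElliptic] [W.IsGloballyMinimal] [NeZero (W.conductorNorm ℤ)] (K : Type)
      [Field K] [NumberField K] (Dt : ModularParametrizationData W (W.conductorNorm ℤ)) (β : ℤ) (ι : K →+* ℂ),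
      Summit.BirchSwinnertonDyer.Rank1Residual.ClassX11b W 3 → W.HasMultiplicativeReductionAtPrime 3 →
      Literature.NumberTheory.EllipticCurves.Rank1Residual.Surj W 3 →
      Literature.NumberTheory.EllipticCurves.Rank1Residual.Ram W 3 → ¬ 3 ∣ W.tamagawaProduct →
      IsImaginaryQuadratic K → Odd (NumberField.discr K) → SatisfiesHeegnerHypothesis (W.conductorNorm ℤ) K →
      (W.quadraticTwist (NumberField.discr K : ℚ)).entireLFunction 1 ≠ 0 → NumberField.discr K ≠ -3 →
      (4 * (W.conductorNorm ℤ : ℤ)) ∣ β ^ 2 - NumberField.discr K → ¬ (3 : ℤ) ∣ Dt.c →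
      ∀ (c : K ≃ₐ[ℚ] K), c ≠ 1 → ∀ [Module (ZMod 3) (V3 W K)],
      -- (Cheb-Gal)
      (∀ (n : Finset {q // IsUAdmissiblePrime W K q}) (μ : Bool) (x : V3 W K), GoodLevel W K n →
        x ∈ SelQ W K c n μ → x ≠ 0 →
        ∃ q : {q // IsUAdmissiblePrime W K q}, q ∉ n ∧ FrobSqNeOneAt W 3 q.1 ∧
          ∃ (v : HeightOneSpectrum (𝓞 K)) (𝔔 : Ideal (absIntegers (𝓞 K) K)) (F : absoluteGaloisGroup K),
            ((q : ℕ) : 𝓞 K) ∈ v.asIdeal ∧ 𝔔 ∈ v.primesAbove ∧ IsArithFrobAt (𝓞 K) F 𝔔 ∧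
            ∀ m : geomTorsion (W.baseChange K) ((3 ^ 1 : ℕ) : ℤ),
              h1Eval (W.baseChange K) ((3 ^ 1 : ℕ) : ℤ) x F ≠ F • m - m) ∧
      -- (Iso)
      (∀ (n : Finset {q // IsUAdmissiblePrime W K q}) (q : {q // IsUAdmissiblePrime W K q}) (μ : Bool),
        GoodLevel W K n → FrobSqNeOneAt W 3 q.1 → q ∉ n →
        ∀ v : HeightOneSpectrum (𝓞 K), ((q : ℕ) : 𝓞 K) ∈ v.asIdeal →
        ∀ y ∈ SelRelQ W K c (insert q n) {q} μ, ∀ z ∈ SelRelQ W K c (insert q n) {q} μ,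
          (W.baseChange K).torsionLocMap (v.adicCompletion K) ((3 ^ 1 : ℕ) : ℤ) z ≠ 0 →
          ∃ a : ℤ, (W.baseChange K).torsionLocMap (v.adicCompletion K) ((3 ^ 1 : ℕ) : ℤ) y =
            a • (W.baseChange K).torsionLocMap (v.adicCompletion K) ((3 ^ 1 : ℕ) : ℤ) z)) :
    ∀ (W : WeierstrassCurve ℚ) [W.IsElliptic] [W.IsGloballyMinimal] [NeZero (W.conductorNorm ℤ)] (K : Type)
      [Field K] [NumberField K] (Dt : ModularParametrizationData W (W.conductorNorm ℤ)) (β : ℤ) (ι : K →+* ℂ),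
      Summit.BirchSwinnertonDyer.Rank1Residual.ClassX11b W 3 → W.HasMultiplicativeReductionAtPrime 3 →
      Literature.NumberTheory.EllipticCurves.Rank1Residual.Surj W 3 →
      Literature.NumberTheory.EllipticCurves.Rank1Residual.Ram W 3 → ¬ 3 ∣ W.tamagawaProduct →
      IsImaginaryQuadratic K → Odd (NumberField.discr K) → SatisfiesHeegnerHypothesis (W.conductorNorm ℤ) K →
      (W.quadraticTwist (NumberField.discr K : ℚ)).entireLFunction 1 ≠ 0 → NumberField.discr K ≠ -3 →
      (4 * (W.conductorNorm ℤ : ℤ)) ∣ β ^ 2 - NumberField.discr K → ¬ (3 : ℤ) ∣ Dt.c →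
      ∀ (c : K ≃ₐ[ℚ] K), c ≠ 1 → ∀ [Module (ZMod 3) (V3 W K)],
      -- (A1) rank lowering at one new GOOD (non-scalar) unipotent-admissible prime, on good levels, (9.1)–(9.2)
      (∀ (n : Finset {q // IsUAdmissiblePrime W K q}) (μ : Bool) (x : V3 W K),
        GoodLevel W K n → x ∈ SelQ W K c n μ → x ≠ 0 →
        ∃ q : {q // IsUAdmissiblePrime W K q}, q ∉ n ∧ GoodLevel W K (insert q n) ∧
          x ∉ SelQ W K c (insert q n) μ ∧
          SelQ W K c (insert q n) μ ≤ SelQ W K c n μ ∧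
          finrank (ZMod 3) (SelQ W K c (insert q n) μ) + 1 = finrank (ZMod 3) (SelQ W K c n μ) ∧
          SelQ W K c (insert q n) (!μ) = SelQ W K c n (!μ)) := by
  intro W _ _ _ K _ _ Dt β ι hX hmult hsurj hram htam hK hodd hH hLt h3 hβ hc c hc1 _
  obtain ⟨hgal, hiso⟩ := hLG W K Dt β ι hX hmult hsurj hram htam hK hodd hH hLt h3 hβ hc c hc1
  exact selQ_rankLowering_on_of_localGlobal W K c (localCheb_of_galoisCheb W K c hgal)
    (localEquiv_of_uAdmissible W K hK.1 hc1) (localLine_of_uAdmissible W K hK.1)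
    (localTrans_of_uAdmissible W K hK.1) hiso

/-- **THE ROUTE DECL BY NAME from (Cheb-Gal) + (Iso) + stub B + four published facts.** Composition of
`stub_levelRaisingAtThree_of_cheb_iso` (this file: (Line), (Trans), (Equiv) are kernel theorems) with koly3a's
`zhangSharpFrameAtThreeHL_of_rankLowering_of_classes_of_oddSelmerRank` (Zhang's §9 induction on good levels, odd
start) and koly g12's `stub_oddSelmerRankAtThree_of_published` (3-parity of `Sel₃(E/K)` at a Hoffstein–Luo frame from
Gross–Zagier, Kolyvagin, modularity and the Cassels–Tate pairing). Hypotheses: (Cheb) and (Iso) frame-wise (koly MEMO-v8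
§§4–5); `hB` = the registered stub B `stub_kolyvaginClassesAtThree` text ((A2)(A3)(A5) realised by the Kolyvagin classes
— the crux's unprinted content at `p = 3`); the four named facts. CONDITIONAL; nothing is booked; the crux is NOT
claimed. [cite: WZhang2014, Thm. 9.1, §9 (9.1)–(9.3), Prop. 5.4, Lemma 7.3] [cite: GrossZagier1986, Thm. I.6.3]
[cite: Kolyvagin1990, Thm. A] -/
theorem zhangSharpFrameAtThreeHL_of_galoisCheb_iso_of_classes_of_published
    (hLG : ∀ (W : WeierstrassCurve ℚ) [W.IsElliptic] [W.IsGloballyMinimal] [NeZero (W.conductorNorm ℤ)] (K : Type)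
      [Field K] [NumberField K] (Dt : ModularParametrizationData W (W.conductorNorm ℤ)) (β : ℤ) (ι : K →+* ℂ),
      Summit.BirchSwinnertonDyer.Rank1Residual.ClassX11b W 3 → W.HasMultiplicativeReductionAtPrime 3 →
      Literature.NumberTheory.EllipticCurves.Rank1Residual.Surj W 3 →
      Literature.NumberTheory.EllipticCurves.Rank1Residual.Ram W 3 → ¬ 3 ∣ W.tamagawaProduct →
      IsImaginaryQuadratic K → Odd (NumberField.discr K) → SatisfiesHeegnerHypothesis (W.conductorNorm ℤ) K →
      (W.quadraticTwist (NumberField.discr K : ℚ)).entireLFunction 1 ≠ 0 → NumberField.discr K ≠ -3 →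
      (4 * (W.conductorNorm ℤ : ℤ)) ∣ β ^ 2 - NumberField.discr K → ¬ (3 : ℤ) ∣ Dt.c →
      ∀ (c : K ≃ₐ[ℚ] K), c ≠ 1 → ∀ [Module (ZMod 3) (V3 W K)],
      -- (Cheb-Gal)
      (∀ (n : Finset {q // IsUAdmissiblePrime W K q}) (μ : Bool) (x : V3 W K), GoodLevel W K n →
        x ∈ SelQ W K c n μ → x ≠ 0 →
        ∃ q : {q // IsUAdmissiblePrime W K q}, q ∉ n ∧ FrobSqNeOneAt W 3 q.1 ∧
          ∃ (v : HeightOneSpectrum (𝓞 K)) (𝔔 : Ideal (absIntegers (𝓞 K) K)) (F : absoluteGaloisGroup K),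
            ((q : ℕ) : 𝓞 K) ∈ v.asIdeal ∧ 𝔔 ∈ v.primesAbove ∧ IsArithFrobAt (𝓞 K) F 𝔔 ∧
            ∀ m : geomTorsion (W.baseChange K) ((3 ^ 1 : ℕ) : ℤ),
              h1Eval (W.baseChange K) ((3 ^ 1 : ℕ) : ℤ) x F ≠ F • m - m) ∧
      -- (Iso)
      (∀ (n : Finset {q // IsUAdmissiblePrime W K q}) (q : {q // IsUAdmissiblePrime W K q}) (μ : Bool),
        GoodLevel W K n → FrobSqNeOneAt W 3 q.1 → q ∉ n →
        ∀ v : HeightOneSpectrum (𝓞 K), ((q : ℕ) : 𝓞 K) ∈ v.asIdeal →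
        ∀ y ∈ SelRelQ W K c (insert q n) {q} μ, ∀ z ∈ SelRelQ W K c (insert q n) {q} μ,
          (W.baseChange K).torsionLocMap (v.adicCompletion K) ((3 ^ 1 : ℕ) : ℤ) z ≠ 0 →
          ∃ a : ℤ, (W.baseChange K).torsionLocMap (v.adicCompletion K) ((3 ^ 1 : ℕ) : ℤ) y =
            a • (W.baseChange K).torsionLocMap (v.adicCompletion K) ((3 ^ 1 : ℕ) : ℤ) z))
    (hB : ∀ (W : WeierstrassCurve ℚ) [W.IsElliptic] [W.IsGloballyMinimal] [NeZero (W.conductorNorm ℤ)] (K : Type)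
      [Field K] [NumberField K] (Dt : ModularParametrizationData W (W.conductorNorm ℤ)) (β : ℤ) (ι : K →+* ℂ),
      Summit.BirchSwinnertonDyer.Rank1Residual.ClassX11b W 3 → W.HasMultiplicativeReductionAtPrime 3 →
      Literature.NumberTheory.EllipticCurves.Rank1Residual.Surj W 3 →
      Literature.NumberTheory.EllipticCurves.Rank1Residual.Ram W 3 → ¬ 3 ∣ W.tamagawaProduct →
      IsImaginaryQuadratic K → Odd (NumberField.discr K) → SatisfiesHeegnerHypothesis (W.conductorNorm ℤ) K →
      (W.quadraticTwist (NumberField.discr K : ℚ)).entireLFunction 1 ≠ 0 → NumberField.discr K ≠ -3 →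
      (4 * (W.conductorNorm ℤ : ℤ)) ∣ β ^ 2 - NumberField.discr K → ¬ (3 : ℤ) ∣ Dt.c →
      ∀ (c : K ≃ₐ[ℚ] K), c ≠ 1 → ∀ [Module (ZMod 3) (V3 W K)],
      ∃ (κ : {x : (n : ℕ) × KolyvaginHeegnerData Dt β ι n //
              KolyvaginDescent.KolSupp (Zhang2014.IsKolyvaginPrime (W.conductorNorm ℤ) W K 3) x.1} →
            Finset {q // IsUAdmissiblePrime W K q} → V3 W K)
        (m₁ : {x : (n : ℕ) × KolyvaginHeegnerData Dt β ι n //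
              KolyvaginDescent.KolSupp (Zhang2014.IsKolyvaginPrime (W.conductorNorm ℤ) W K 3) x.1}),
        (∀ m, κ m ∅ = m.1.2.kolyvaginClass Nat.prime_three 1) ∧
        (∀ (n : Finset {q // IsUAdmissiblePrime W K q}) (q₁ q₂ : {q // IsUAdmissiblePrime W K q}),
          GoodLevel W K n → GoodLevel W K (insert q₁ n) → GoodLevel W K (insert q₂ (insert q₁ n)) →
          q₁ ∉ n → q₂ ∉ insert q₁ n → q₂ ∉ baseLocusQ W K κ (insert q₂ (insert q₁ n)) → ∃ m, κ m n ≠ 0) ∧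
        (∀ (n : Finset {q // IsUAdmissiblePrime W K q}), GoodLevel W K n → Even n.card → (∃ m, κ m n ≠ 0) →
          ∃ (s : Bool) (d : ℕ), finrank (ZMod 3) (SelQ W K c n s) = d + 1 ∧
            SelQ W K c n s = SelRelQ W K c n (baseLocusQ W K κ n) s ∧
            FiniteDimensional (ZMod 3) (SelRelQ W K c n (baseLocusQ W K κ n) (!s)) ∧
            finrank (ZMod 3) (SelRelQ W K c n (baseLocusQ W K κ n) (!s)) ≤ d) ∧
        (∀ (n : Finset {q // IsUAdmissiblePrime W K q}), GoodLevel W K n → Even n.card →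
          finrank (ZMod 3) (SelQ W K c n true) + finrank (ZMod 3) (SelQ W K c n false) = 1 → κ m₁ n ≠ 0))
    (hGZ : ∀ (N : ℕ) [NeZero N] (W : WeierstrassCurve ℚ) (K : Type) [Field K] [NumberField K], gross_zagier N W K)
    (hKo : ∀ (N : ℕ) [NeZero N] (W : WeierstrassCurve ℚ) (K : Type) [Field K] [NumberField K], kolyvagin N W K)
    (hmod : hasEntireLFunction_rat)
    (hCT : ∀ (F : Type) [Field F] [NumberField F], exists_casselsTate_pairing (K := F)) :
    Summit.BirchSwinnertonDyer.BirchSwinnertonDyer.Theses.KolyvaginRoadThree.ZhangSharpFrameAtThreeHL :=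
  zhangSharpFrameAtThreeHL_of_rankLowering_of_classes_of_oddSelmerRank (stub_levelRaisingAtThree_of_galoisCheb_iso hLG)
    hB (stub_oddSelmerRankAtThree_of_published hGZ hKo hmod hCT)

end Summit.BirchSwinnertonDyer.Rank1Residual.X11b.Three.Koly.Method2

end
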